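import Literature.Barriers.CriticalPhenomena.SupercriticalSAWSpaceFillingBoxesMerge
import Mathlib.Combinatorics.SimpleGraph.Acyclic
import HarnessLib

/-!
# Supercritical self-avoiding walks are space-filling (Duminil-Copin–Kozma–Yadin 2014):
# proof of the Claim in the proof of Proposition 7 (`DKY2014_prop7_claim_holds`)

Fourth companion file of `SupercriticalSAWSpaceFillingBoxes.lean`: the named fact
`DKY2014_prop7_claim` of that file — the Claim "For `F ∈ 𝓕(Ω_δ, m)`, `Z_F(x) ≥ Z_m(x)^{|F|}`"
in the proof of Proposition 7 of H. Duminil-Copin, G. Kozma, A. Yadin, *Supercritical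
self-avoiding walks are space-filling*, Ann. IHP Probab. Stat. 50 (2014) 315–326,
arXiv:1110.3074, §3, in its form for boxes with moats (`x^{4g|F|} Z_n(x)^{|F|} ≤ x^{4g} Z_F(x)`
for `x ≥ 0` and `F` nonempty connected) — is PROVED, following the printed induction:

* geometry of the regions (`eq_of_mem_innerBox`: inner boxes of different boxes are disjoint;
  `rungPt_notMem_innerBox`: rung cells lie in the moats; `eq_of_rungPt_mem_rungCells`:
  different rungs are disjoint; `innerCardinalEdge_injective`: an inner cardinal edge
  determines its box, axis and side), whence the merge hypotheses for a family `F`, a box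
  `B ∉ F` adjacent to `z' ∈ F` on either side (`mergeData_inr`, `mergeData_inl`), and the
  merged polygon belongs to `S_{F ∪ {B}}` (`mergeEdges_mem_familyPolygons`: it lies in the
  polygon region of `insert B F` and keeps every external inner cardinal edge, the two deleted
  ones having become internal);
* the induction step "`Z_{F₀}(x) ≥ Z_{F₀∖{B}}(x) Z_B(x)`", here
  `x^{4g} Z_F(x) Z_n(x) ≤ Z_{F ∪ {B}}(x)` (`familyPartition_insert_ge`), by the injection
  `(E, E') ↦ merge(E, E' + c_B)` of `S_F × P_n` into `S_{F ∪ {B}}` of size `|E| + |E'| + 4g`;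
* "There exists a box `B` in `F₀` such that `F₀ ∖ {B}` is still connected", adjacent to a box
  of `F₀ ∖ {B}` (`exists_erase_isConnectedFamily`, from Mathlib's
  `SimpleGraph.Connected.exists_preconnected_induce_compl_singleton_of_finite`);
* the induction on `|F|` (`pow_mul_Zbox_pow_le_familyPartition`) and
  `DKY2014_prop7_claim_holds`.
-/

noncomputable section

open SimpleGraph Literature.Probability.LatticeModels Literature.Probability.Percolation
  Literature.Probability.RandomPlanarGeometry.SAW

namespace Literature.Barriers.CriticalPhenomena

namespace SupercriticalSAW

/-! ### Geometry of the regions: inner boxes, rung cells and cardinal edges are told apart -/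

/-- If `N a ≤ N b + r` and `N b ≤ N a + r` with `r < N`, then `a = b`. [folklore] -/
theorem int_eq_of_mul_le_mul_add {N a b r : ℤ} (hN : 0 < N) (hr : r < N) (h₁ : N * a ≤ N * b + r)
    (h₂ : N * b ≤ N * a + r) : a = b := by
  by_contra hne
  rcases lt_or_gt_of_ne hne with hlt | hlt <;> nlinarith

/-- **Inner boxes of different boxes are disjoint**: a common site forces the same corner.
[cite: DuminilCopinKozmaYadin2014, §3 (m-boxes)] -/
theorem eq_of_mem_innerBox {n g : ℕ} {z z' v : Site 2} (h : v ∈ innerBox n g z)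
    (h' : v ∈ innerBox n g z') : z = z' := by
  rw [mem_innerBox_iff] at h h'
  funext k
  obtain ⟨h1, h2⟩ := h k
  obtain ⟨h1', h2'⟩ := h' k
  refine int_eq_of_mul_le_mul_add (N := 2 * ((n + g : ℕ) : ℤ) + 2) (r := 2 * n + 1) (by positivity)
    (by push_cast; linarith) (by linarith) (by linarith)

/-- **Rung cells lie in the moats**: no rung point of index `1 ≤ k ≤ 2g` is in an inner box.
[cite: DuminilCopinKozmaYadin2014, §3 (m-boxes; proof of the Claim)] -/
theorem rungPt_notMem_innerBox {n g : ℕ} {z : Site 2} {i : Fin 2} {k : ℕ} (hk : 1 ≤ k)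
    (hk' : k ≤ 2 * g) (t : Bool) (z' : Site 2) : rungPt n g z i k t ∉ innerBox n g z' := by
  intro hmem
  rw [mem_innerBox_iff] at hmem
  obtain ⟨h1, h2⟩ := hmem i
  rw [rungPt_apply_self] at h1 h2
  push_cast at h1 h2
  have hk1 : (1 : ℤ) ≤ k := by exact_mod_cast hk
  have hk2 : (k : ℤ) ≤ 2 * g := by exact_mod_cast hk'
  have hd : 1 ≤ z' i - z i := by
    by_contra hcon
    rw [not_le] at hcon
    nlinarith
  nlinarith

/-- **Different rungs are disjoint**: a rung point of index `1 ≤ k ≤ 2g` of the rung of `B(z)`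
towards `+eᵢ` that is a rung cell of the rung of `B(z')` towards `+e_j` forces `z' = z` and
`j = i`. [cite: DuminilCopinKozmaYadin2014, §3 (proof of the Claim)] -/
theorem eq_of_rungPt_mem_rungCells {n g : ℕ} {z z' : Site 2} {i j : Fin 2} {k : ℕ} {t : Bool}
    (hk : 1 ≤ k) (hk' : k ≤ 2 * g) (h : rungPt n g z i k t ∈ rungCells n g z' j) :
    z' = z ∧ j = i := by
  obtain ⟨k', hk₁, hk₂, t', he⟩ := mem_rungCells_iff.1 h
  have hk1 : (1 : ℤ) ≤ k := by exact_mod_cast hk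
  have hk2 : (k : ℤ) ≤ 2 * g := by exact_mod_cast hk'
  have hk1' : (1 : ℤ) ≤ k' := by exact_mod_cast hk₁
  have hk2' : (k' : ℤ) ≤ 2 * g := by exact_mod_cast hk₂
  have hb : ∀ b : Bool, (0 : ℤ) ≤ (if b then 1 else 0) ∧ (if b then (1 : ℤ) else 0) ≤ 1 := by
    intro b; cases b <;> simp
  by_cases hj : j = i
  · subst hj
    refine ⟨?_, rfl⟩
    have hi := congrFun he j
    have hn := congrFun he (j + 1)
    rw [rungPt_apply_self, rungPt_apply_self] at hi
    rw [rungPt_apply_next, rungPt_apply_next] at hn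
    push_cast at hi hn
    funext l
    by_cases hl : l = j
    · subst hl
      exact (int_eq_of_mul_le_mul_add (N := 2 * ((n : ℤ) + g) + 2) (r := 2 * g) (by positivity)
        (by linarith) (by linarith) (by linarith)).symm
    · have hl' := fin_two_eq_add_one_of_ne hl
      subst hl'
      have h1 := hb t
      have h2 := hb t'
      exact (int_eq_of_mul_le_mul_add (N := 2 * ((n : ℤ) + g) + 2) (r := 1) (by positivity)
        (by linarith) (by linarith) (by linarith)).symm
  · exfalso
    have hj' := fin_two_eq_add_one_of_ne hj
    subst hj'
    -- compare the `i`-th coordinates: `2n+1+k` past the inner corner of `B(z)` versus `n + b'`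
    -- past that of `B(z')`
    have hi := congrFun he i
    have hi' : rungPt n g z' (i + 1) k' t' i = rungPt n g z' (i + 1) k' t' (i + 1 + 1) := by
      rw [fin_two_add_one_add_one]
    rw [rungPt_apply_self, hi', rungPt_apply_next, fin_two_add_one_add_one] at hi
    push_cast at hi
    have h2 := hb t'
    have hN : (0 : ℤ) < 2 * ((n : ℤ) + g) + 2 := by positivity
    -- `N (z i - z' i) = n + b' - (2n+1+k) ∈ [-(n+2g+1), -n]`, strictly between `-N` and `0`
    have hlt : (2 * ((n : ℤ) + g) + 2) * (z i - z' i) < 0 := by nlinarith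
    have hgt : -(2 * ((n : ℤ) + g) + 2) < (2 * ((n : ℤ) + g) + 2) * (z i - z' i) := by nlinarith
    have hneg : z i - z' i < 0 := by
      by_contra hcon; rw [not_lt] at hcon; nlinarith
    have : z i - z' i ≤ -1 := by omega
    nlinarith

/-- The endpoints of an inner cardinal edge of `B(z)` lie in the inner box of `B(z)`.
[cite: DuminilCopinKozmaYadin2014, §3 (cardinal edges)] -/
theorem mem_innerBox_of_mem_innerCardinalEdge {n g : ℕ} {z : Site 2} {j : Fin 2} {t : Bool}
    {v : Site 2} (hv : v ∈ innerCardinalEdge n g z j t) : v ∈ innerBox n g z := by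
  rw [mem_innerBox_iff]
  simp only [innerCardinalEdge, Sym2.mem_iff] at hv
  intro l
  rcases hv with rfl | rfl
  · by_cases hl : l = j
    · subst hl; cases t <;> simp [innerCorner] <;> positivity
    · simp [innerCorner, hl]; omega
  · by_cases hl : l = j
    · subst hl; cases t <;> simp [innerCorner] <;> positivity
    · have hl' := fin_two_eq_add_one_of_ne hl
      subst hl'
      simp [innerCorner]; omega

/-- The `j`-th coordinate is constant on an inner cardinal edge on a side `(j, ·)`.
[cite: DuminilCopinKozmaYadin2014, §3 (cardinal edges)] -/
theorem apply_eq_of_mem_innerCardinalEdge {n g : ℕ} {z : Site 2} {j : Fin 2} {t : Bool}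
    {v : Site 2} (hv : v ∈ innerCardinalEdge n g z j t) :
    v j = innerCorner n g z j + if t then 2 * (n : ℤ) + 1 else 0 := by
  simp only [innerCardinalEdge, Sym2.mem_iff] at hv
  rcases hv with rfl | rfl
  · simp
  · simp

/-- The `(j+1)`-th coordinate takes two different values on an inner cardinal edge on a side
`(j, ·)`. [cite: DuminilCopinKozmaYadin2014, §3 (cardinal edges)] -/
theorem exists_apply_ne_of_innerCardinalEdge (n g : ℕ) (z : Site 2) (j : Fin 2) (t : Bool) :
    ∃ v ∈ innerCardinalEdge n g z j t, ∃ w ∈ innerCardinalEdge n g z j t,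
      v (j + 1) ≠ w (j + 1) := by
  simp only [innerCardinalEdge]
  refine ⟨_, Sym2.mem_mk_left _ _, _, Sym2.mem_mk_right _ _, ?_⟩
  simp

/-- **Inner cardinal edges are told apart**: the edge determines the box, the axis and the side.
[cite: DuminilCopinKozmaYadin2014, §3 (cardinal edges)] -/
theorem innerCardinalEdge_injective {n g : ℕ} {z z' : Site 2} {j j' : Fin 2} {t t' : Bool}
    (h : innerCardinalEdge n g z j t = innerCardinalEdge n g z' j' t') :
    z = z' ∧ j = j' ∧ t = t' := by
  obtain ⟨v, hv, w, hw, hvw⟩ := exists_apply_ne_of_innerCardinalEdge n g z j t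
  have hz : z = z' :=
    eq_of_mem_innerBox (mem_innerBox_of_mem_innerCardinalEdge hv)
      (mem_innerBox_of_mem_innerCardinalEdge (h ▸ hv))
  subst hz
  have hj : j = j' := by
    by_contra hne
    have hj' : j' = j + 1 := fin_two_eq_add_one_of_ne (Ne.symm hne) |>.trans (by rfl)
    subst hj'
    have h1 := apply_eq_of_mem_innerCardinalEdge (h ▸ hv)
    have h2 := apply_eq_of_mem_innerCardinalEdge (h ▸ hw)
    exact hvw (h1.trans h2.symm)
  subst hj
  refine ⟨rfl, rfl, ?_⟩
  have h1 := apply_eq_of_mem_innerCardinalEdge hv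
  have h2 := apply_eq_of_mem_innerCardinalEdge (h ▸ hv)
  rw [h1] at h2
  cases t <;> cases t' <;> simp at h2 ⊢ <;> omega

/-! ### The polygon region of `F` against a new box `B ∉ F` and the rung towards it -/

/-- The inner box of a box not in `F` is disjoint from the polygon region of `F`.
[cite: DuminilCopinKozmaYadin2014, §3 (proof of the Claim)] -/
theorem disjoint_polygonRegion_innerBox {n g : ℕ} {F : Finset (Site 2)} {B : Site 2} (hB : B ∉ F) :
    Disjoint (polygonRegion n g F) (innerBox n g B) := by
  rw [Finset.disjoint_left]
  intro v hv hvB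
  rcases mem_polygonRegion_iff.1 hv with ⟨z, hz, hvz⟩ | ⟨j, z, hz, -, hvz⟩
  · exact hB (eq_of_mem_innerBox hvB hvz ▸ hz)
  · obtain ⟨k, hk, hk', t, rfl⟩ := mem_rungCells_iff.1 hvz
    exact rungPt_notMem_innerBox hk hk' t B hvB

/-- The rung cells of a rung not joining two boxes of `F` avoid the polygon region of `F`.
[cite: DuminilCopinKozmaYadin2014, §3 (proof of the Claim)] -/
theorem rungPt_notMem_polygonRegion {n g : ℕ} {F : Finset (Site 2)} {z : Site 2} {i : Fin 2}
    (hz : ¬(z ∈ F ∧ z + Pi.single i 1 ∈ F)) {k : ℕ} (hk : 1 ≤ k) (hk' : k ≤ 2 * g) (t : Bool) :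
    rungPt n g z i k t ∉ polygonRegion n g F := by
  intro hv
  rcases mem_polygonRegion_iff.1 hv with ⟨z', -, hvz⟩ | ⟨j, z', hz', hz'', hvz⟩
  · exact rungPt_notMem_innerBox hk hk' t z' hvz
  · obtain ⟨rfl, rfl⟩ := eq_of_rungPt_mem_rungCells hk hk' hvz
    exact hz ⟨hz', hz''⟩

/-- **The merge data, new box on the `+eᵢ` side**: `B = z' + eᵢ ∉ F`, `z' ∈ F`, `E ∈ S_F`,
`E' ∈ P_n` translated into `B`. [cite: DuminilCopinKozmaYadin2014, §3 (proof of the Claim)] -/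
theorem mergeData_inr {n g : ℕ} {F : Finset (Site 2)} {z' : Site 2} {i : Fin 2}
    (hz' : z' ∈ F) (hB : z' + Pi.single i 1 ∉ F) {E E' : Finset (Sym2 (Site 2))}
    (hE : E ∈ familyPolygons n g F) (hE' : E' ∈ facePolygons n) :
    MergeData n g z' i (polygonRegion n g F) (innerBox n g (z' + Pi.single i 1)) E
      (shiftEdges (innerCorner n g (z' + Pi.single i 1)) E') := by
  obtain ⟨hP, hsub, hcard⟩ := shiftEdges_facePolygons (g := g) (z' + Pi.single i 1) hE'
  rw [mem_familyPolygons_iff] at hE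
  refine ⟨disjoint_polygonRegion_innerBox hB, fun k hk hk' t => ⟨?_, ?_⟩, hE.2.1, hE.1, ?_, hP,
    hsub, hcard i false⟩
  · exact rungPt_notMem_polygonRegion (fun h => hB h.2) hk hk' t
  · exact rungPt_notMem_innerBox hk hk' t _
  · exact hE.2.2 z' hz' i true (by rwa [dirVec_true])

/-- **The merge data, new box on the `-eᵢ` side**: `B ∉ F`, `B + eᵢ ∈ F`, `E ∈ S_F`, `E' ∈ P_n`
translated into `B`. [cite: DuminilCopinKozmaYadin2014, §3 (proof of the Claim)] -/
theorem mergeData_inl {n g : ℕ} {F : Finset (Site 2)} {B : Site 2} {i : Fin 2}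
    (hB : B ∉ F) (hz' : B + Pi.single i 1 ∈ F) {E E' : Finset (Sym2 (Site 2))}
    (hE : E ∈ familyPolygons n g F) (hE' : E' ∈ facePolygons n) :
    MergeData n g B i (innerBox n g B) (polygonRegion n g F)
      (shiftEdges (innerCorner n g B) E') E := by
  obtain ⟨hP, hsub, hcard⟩ := shiftEdges_facePolygons (g := g) B hE'
  rw [mem_familyPolygons_iff] at hE
  refine ⟨(disjoint_polygonRegion_innerBox hB).symm, fun k hk hk' t => ⟨?_, ?_⟩, hP, hsub,
    hcard i true, hE.2.1, hE.1, ?_⟩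
  · exact rungPt_notMem_innerBox hk hk' t _
  · exact rungPt_notMem_polygonRegion (fun h => hB h.1) hk hk' t
  · refine hE.2.2 _ hz' i false ?_
    rwa [dirVec_false, add_neg_cancel_right]

/-- **The merge is a polygon of `S_{F ∪ {B}}`**: inside the polygon region of `insert B F` and
through every external inner cardinal edge of `insert B F` (the two removed edges have become
internal, every other required edge is inherited from `E` or from the translate of `E'`).
[cite: DuminilCopinKozmaYadin2014, §3 (proof of the Claim: "one obtains a polygon in S_F")] -/
theorem mergeEdges_mem_familyPolygons {n g : ℕ} {F : Finset (Site 2)} {B zl : Site 2} {i : Fin 2}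
    {R₁ R₂ : Finset (Site 2)} {E₁ E₂ E E' : Finset (Sym2 (Site 2))} (hB : B ∉ F)
    (h : MergeData n g zl i R₁ R₂ E₁ E₂) (hR : R₁ ∪ R₂ ⊆ polygonRegion n g F ∪ innerBox n g B)
    (hU : E₁ ∪ E₂ = E ∪ shiftEdges (innerCorner n g B) E') (hzl : zl ∈ insert B F)
    (hzr : zl + Pi.single i 1 ∈ insert B F) (hE : E ∈ familyPolygons n g F)
    (hE' : E' ∈ facePolygons n) :
    mergeEdges n g zl i (E₁ ∪ E₂) ∈ familyPolygons n g (insert B F) := by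
  rw [mem_familyPolygons_iff]
  refine ⟨h.subset.trans (edgesIn_subset_of_subset ?_), h.isPolygon, fun z₀ hz₀ j t hzt => ?_⟩
  · refine Finset.union_subset (hR.trans (Finset.union_subset ?_ ?_)) ?_
    · exact polygonRegion_mono (Finset.subset_insert _ _)
    · exact innerBox_subset_polygonRegion (Finset.mem_insert_self _ _)
    · exact rungCells_subset_polygonRegion hzl hzr
  · -- the required edge is an edge of `E` or of the translate of `E'` …
    have hmem : innerCardinalEdge n g z₀ j t ∈ E₁ ∪ E₂ := by
      rw [hU, Finset.mem_union]
      rcases Finset.mem_insert.1 hz₀ with rfl | hz₀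
      · exact Or.inr ((shiftEdges_facePolygons (g := g) z₀ hE').2.2 j t)
      · refine Or.inl ((mem_familyPolygons_iff.1 hE).2.2 z₀ hz₀ j t fun h' => hzt ?_)
        exact Finset.mem_insert_of_mem h'
    -- … and it is neither of the two removed (now internal) edges
    rw [mergeEdges, Finset.mem_union, Finset.mem_sdiff, Finset.mem_insert, Finset.mem_singleton]
    refine Or.inl ⟨hmem, ?_⟩
    rintro (heq | heq)
    · obtain ⟨rfl, rfl, rfl⟩ := innerCardinalEdge_injective heq
      exact hzt (by rwa [dirVec_true])
    · obtain ⟨rfl, rfl, rfl⟩ := innerCardinalEdge_injective heq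
      exact hzt (by rwa [dirVec_false, add_neg_cancel_right])

/-- Counting through an injection: if `Φ` maps `S` injectively into `T` with `|Φ a| = c a`, then
`Σ_{a ∈ S} x^{c a} ≤ Σ_{M ∈ T} x^{|M|}` for `x ≥ 0`. [folklore] -/
theorem sum_pow_le_sum_pow_card {α β : Type*} [DecidableEq β] {S : Finset α}
    {T : Finset (Finset β)} (Φ : α → Finset β) (c : α → ℕ) (hmem : ∀ a ∈ S, Φ a ∈ T)
    (hcard : ∀ a ∈ S, (Φ a).card = c a) (hinj : Set.InjOn Φ S) {x : ℝ} (hx : 0 ≤ x) :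
    ∑ a ∈ S, x ^ c a ≤ ∑ M ∈ T, x ^ M.card := by
  calc ∑ a ∈ S, x ^ c a = ∑ a ∈ S, x ^ (Φ a).card :=
        Finset.sum_congr rfl fun a ha => by rw [hcard a ha]
    _ = ∑ M ∈ S.image Φ, x ^ M.card := by rw [Finset.sum_image hinj]
    _ ≤ ∑ M ∈ T, x ^ M.card :=
        Finset.sum_le_sum_of_subset_of_nonneg (Finset.image_subset_iff.2 hmem)
          fun _ _ _ => pow_nonneg hx _

/-- The double sum `Σ_{(E,E') ∈ S_F × P_n} x^{|E| + |E'| + 4g} = x^{4g} Z_F(x) Z_n(x)`.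
[cite: DuminilCopinKozmaYadin2014, §3 (proof of the Claim)] -/
theorem sum_product_pow (n g : ℕ) (F : Finset (Site 2)) (x : ℝ) :
    ∑ p ∈ familyPolygons n g F ×ˢ facePolygons n, x ^ (p.1.card + p.2.card + 4 * g) =
      x ^ (4 * g) * familyPartition n g F x * Zbox n x := by
  rw [Finset.sum_product, familyPartition, Zbox, mul_assoc, Finset.sum_mul_sum, Finset.mul_sum]
  refine Finset.sum_congr rfl fun E _ => ?_
  rw [Finset.mul_sum]
  refine Finset.sum_congr rfl fun E' _ => ?_
  dsimp only
  rw [pow_add, pow_add]; ring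

/-- **The induction step of the Claim** ("`Z_{F₀}(x) ≥ Z_{F₀∖{B}}(x) Z_B(x)`", here with the cost
`x^{4g}` of the two rungs): for `B ∉ F` adjacent to a box of `F`,
`x^{4g} Z_F(x) Z_n(x) ≤ Z_{F ∪ {B}}(x)` for `x ≥ 0`, by the injection
`(E, E') ↦ merge(E, E' + c_B)` of `S_F × P_n` into `S_{F ∪ {B}}`.
[cite: DuminilCopinKozmaYadin2014, §3 (proof of the Claim)] -/
theorem familyPartition_insert_ge {n g : ℕ} {F : Finset (Site 2)} {B z' : Site 2} {i : Fin 2}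
    {s : Bool} (hB : B ∉ F) (hz' : z' ∈ F) (hBz : B = z' + dirVec i s) {x : ℝ} (hx : 0 ≤ x) :
    x ^ (4 * g) * familyPartition n g F x * Zbox n x ≤ familyPartition n g (insert B F) x := by
  classical
  rw [← sum_product_pow, familyPartition]
  cases s
  · -- `B = z' - eᵢ`: merge across the rung of `B` towards `+eᵢ`
    have hzB : z' = B + Pi.single i 1 := by
      rw [hBz, dirVec_false, neg_add_cancel_right]
    subst hzB
    refine sum_pow_le_sum_pow_card
      (fun p => mergeEdges n g B i (shiftEdges (innerCorner n g B) p.2 ∪ p.1)) _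
      (fun p hp => ?_) (fun p hp => ?_) (fun p hp q hq hpq => ?_) hx
    · obtain ⟨hE, hE'⟩ := Finset.mem_product.1 hp
      exact mergeEdges_mem_familyPolygons hB (mergeData_inl hB hz' hE hE')
        (Finset.union_comm _ _).subset (Finset.union_comm _ _) (Finset.mem_insert_self _ _)
        (Finset.mem_insert_of_mem hz') hE hE'
    · obtain ⟨hE, hE'⟩ := Finset.mem_product.1 hp
      rw [(mergeData_inl hB hz' hE hE').card, card_shiftEdges]; ring
    · obtain ⟨hE, hE'⟩ := Finset.mem_product.1 hp
      obtain ⟨hÊ, hÊ'⟩ := Finset.mem_product.1 hq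
      have h₁ := mergeData_inl (n := n) (g := g) hB hz' hE hE'
      have h₂ := mergeData_inl (n := n) (g := g) hB hz' hÊ hÊ'
      refine Prod.ext ?_ (shiftEdges_injective (innerCorner n g B) ?_)
      · rw [h₁.eq₂, h₂.eq₂]; simp only [hpq]
      · rw [h₁.eq₁, h₂.eq₁]; simp only [hpq]
  · -- `B = z' + eᵢ`: merge across the rung of `z'` towards `+eᵢ`
    have hzB : B = z' + Pi.single i 1 := by rw [hBz, dirVec_true]
    subst hzB
    refine sum_pow_le_sum_pow_card
      (fun p => mergeEdges n g z' i (p.1 ∪ shiftEdges (innerCorner n g (z' + Pi.single i 1)) p.2))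
      _ (fun p hp => ?_) (fun p hp => ?_) (fun p hp q hq hpq => ?_) hx
    · obtain ⟨hE, hE'⟩ := Finset.mem_product.1 hp
      exact mergeEdges_mem_familyPolygons hB (mergeData_inr hz' hB hE hE')
        subset_rfl rfl (Finset.mem_insert_of_mem hz') (Finset.mem_insert_self _ _) hE hE'
    · obtain ⟨hE, hE'⟩ := Finset.mem_product.1 hp
      rw [(mergeData_inr hz' hB hE hE').card, card_shiftEdges]
    · obtain ⟨hE, hE'⟩ := Finset.mem_product.1 hp
      obtain ⟨hÊ, hÊ'⟩ := Finset.mem_product.1 hq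
      have h₁ := mergeData_inr (n := n) (g := g) hz' hB hE hE'
      have h₂ := mergeData_inr (n := n) (g := g) hz' hB hÊ hÊ'
      refine Prod.ext ?_ (shiftEdges_injective (innerCorner n g (z' + Pi.single i 1)) ?_)
      · rw [h₁.eq₁, h₂.eq₁]; simp only [hpq]
      · rw [h₁.eq₂, h₂.eq₂]; simp only [hpq]

/-! ### A box whose removal keeps the family connected -/

/-- **"There exists a box `B` in `F₀` such that `F₀ ∖ {B}` is still connected"** (and, as `F₀` is
connected with at least two boxes, `B` is adjacent to a box of `F₀ ∖ {B}`): a finite connected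
graph has a non-cut vertex (Mathlib's `exists_preconnected_induce_compl_singleton_of_finite`,
a leaf of a spanning tree). [cite: DuminilCopinKozmaYadin2014, §3 (proof of the Claim)] -/
theorem exists_erase_isConnectedFamily {F : Finset (Site 2)} (hF : IsConnectedFamily F)
    (h2 : 2 ≤ F.card) :
    ∃ B ∈ F, IsConnectedFamily (F.erase B) ∧
      ∃ z' ∈ F.erase B, ∃ (i : Fin 2) (s : Bool), B = z' + dirVec i s := by
  classical
  have hne : F.Nonempty := Finset.card_pos.1 (by omega)
  haveI : Nonempty (↑F : Set (Site 2)) := ⟨⟨hne.choose, Finset.mem_coe.2 hne.choose_spec⟩⟩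
  have hconn : ((zdGraph 2).induce (↑F : Set (Site 2))).Connected := ⟨hF⟩
  obtain ⟨v, hv⟩ := hconn.exists_preconnected_induce_compl_singleton_of_finite
  refine ⟨v.1, Finset.mem_coe.1 v.2, ?_, ?_⟩
  · -- transport along the obvious surjective homomorphism
    let φ : ((zdGraph 2).induce (↑F : Set (Site 2))).induce ({v}ᶜ : Set _) →g
        (zdGraph 2).induce (↑(F.erase v.1) : Set (Site 2)) :=
      { toFun := fun w => ⟨w.1.1, by
          rw [Finset.mem_coe, Finset.mem_erase]
          refine ⟨fun h => w.2 ?_, Finset.mem_coe.1 w.1.2⟩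
          rw [Set.mem_singleton_iff]
          exact Subtype.ext h⟩
        map_rel' := fun h => h }
    refine hv.map φ fun w => ?_
    obtain ⟨w, hw⟩ := w
    rw [Finset.mem_coe, Finset.mem_erase] at hw
    refine ⟨⟨⟨w, Finset.mem_coe.2 hw.2⟩, fun h => hw.1 ?_⟩, rfl⟩
    rw [Set.mem_singleton_iff] at h
    exact congrArg Subtype.val h
  · -- a first step of a walk from `v` to another box of `F`
    obtain ⟨w, hw, hwv⟩ : ∃ w ∈ F, w ≠ v.1 := by
      by_contra hcon
      have : F ⊆ {v.1} := fun w hw =>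
        Finset.mem_singleton.2 (by_contra fun hne => hcon ⟨w, hw, hne⟩)
      have := Finset.card_le_card this
      rw [Finset.card_singleton] at this
      omega
    obtain ⟨p⟩ := hF v ⟨w, Finset.mem_coe.2 hw⟩
    cases p with
    | nil => exact absurd rfl hwv
    | cons hadj p' =>
      rename_i v₁
      have hadj' : (zdGraph 2).Adj v.1 v₁.1 := hadj
      have hne' : v₁.1 ≠ v.1 := fun h => hadj'.ne h.symm
      refine ⟨v₁.1, Finset.mem_erase.2 ⟨hne', Finset.mem_coe.1 v₁.2⟩, ?_⟩
      obtain ⟨i, h | h⟩ := (zdGraph_adj_iff _ _).1 hadj'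
      · exact ⟨i, false, by rw [dirVec_false, h, add_neg_cancel_right]⟩
      · exact ⟨i, true, by rw [dirVec_true, h]⟩

/-! ### The Claim -/

/-- **The Claim by induction on `|F|`**: for a connected family `F` of `k+1` boxes,
`x^{4gk} Z_n(x)^{k+1} ≤ Z_F(x)` (`x ≥ 0`). [cite: DuminilCopinKozmaYadin2014, §3 (proof of Proposition 7, Claim)] -/
theorem pow_mul_Zbox_pow_le_familyPartition (n g : ℕ) {x : ℝ} (hx : 0 ≤ x) :
    ∀ (k : ℕ) (F : Finset (Site 2)), F.card = k + 1 → IsConnectedFamily F →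
      x ^ (4 * g * k) * Zbox n x ^ (k + 1) ≤ familyPartition n g F x := by
  intro k
  induction k with
  | zero =>
    intro F hF _
    obtain ⟨z, rfl⟩ := Finset.card_eq_one.1 hF
    simpa using Zbox_le_familyPartition_singleton n g z hx
  | succ k ih =>
    intro F hF hconn
    obtain ⟨B, hB, hconn', z', hz', i, s, hBz⟩ := exists_erase_isConnectedFamily hconn (by omega)
    have hcard : (F.erase B).card = k + 1 := by rw [Finset.card_erase_of_mem hB, hF]; rfl
    have h1 := ih (F.erase B) hcard hconn'
    have h2 := familyPartition_insert_ge (n := n) (g := g) (Finset.notMem_erase B F) hz' hBz hx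
    rw [Finset.insert_erase hB] at h2
    calc x ^ (4 * g * (k + 1)) * Zbox n x ^ (k + 1 + 1)
        = x ^ (4 * g) * (x ^ (4 * g * k) * Zbox n x ^ (k + 1)) * Zbox n x := by ring
      _ ≤ x ^ (4 * g) * familyPartition n g (F.erase B) x * Zbox n x := by
        gcongr
        · exact Zbox_nonneg n hx
      _ ≤ familyPartition n g F x := h2

/-- **The Claim in the proof of Proposition 7 of Duminil-Copin–Kozma–Yadin 2014 holds** (for
the boxes with moats of `SupercriticalSAWSpaceFillingBoxes`): for `x ≥ 0` and a nonempty
connected family `F`, `x^{4g|F|} Z_n(x)^{|F|} ≤ x^{4g} Z_F(x)`. Proof as printed: induction on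
`|F|`, removing a box that keeps the family connected and merging a translated polygon of `P_n`
into the polygon of the remaining family across the rung to an adjacent box.
[cite: DuminilCopinKozmaYadin2014, §3 (proof of Proposition 7, Claim)] -/
theorem DKY2014_prop7_claim_holds : DKY2014_prop7_claim := by
  intro n g x hx F hne hconn
  obtain ⟨k, hk⟩ : ∃ k, F.card = k + 1 := ⟨F.card - 1, by have := hne.card_pos; omega⟩
  have h := pow_mul_Zbox_pow_le_familyPartition n g hx k F hk hconn
  calc x ^ (4 * g * F.card) * Zbox n x ^ F.card
      = x ^ (4 * g) * (x ^ (4 * g * k) * Zbox n x ^ (k + 1)) := by rw [hk]; ring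
    _ ≤ x ^ (4 * g) * familyPartition n g F x :=
      mul_le_mul_of_nonneg_left h (pow_nonneg hx _)

end SupercriticalSAW

end Literature.Barriers.CriticalPhenomena
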